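import Summits.ResolutionOfSingularities.ResolutionOfSingularities.Theorems.SeparableGaloisGaloisQuotientModelsStubFrobeniusCompositum
import Summits.ResolutionOfSingularities.ResolutionOfSingularities.Theorems.SeparableGaloisGaloisQuotientModelsStubSandwichModel
import Summits.ResolutionOfSingularities.ResolutionOfSingularities.Theorems.SeparableGaloisGaloisQuotientModelsStubQuotientModel
import Summits.ResolutionOfSingularities.ResolutionOfSingularities.Theorems.SeparableGaloisGaloisQuotientModelsStubEquivariantLogResolutionOfFact
import Literature.AlgebraicGeometry.Resolution.QuasiProjectiveChowCover
import Literature.AlgebraicGeometry.Resolution.AlterationsProofs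
import Literature.AlgebraicGeometry.Resolution.AlterationsModification
import Literature.AlgebraicGeometry.Resolution.ComponentGluing
import HarnessLib

/-!
# Crux `GaloisQuotientModels` (stmt-ResolutionOfSingularities-18955), line `inseparability-foliation-quotient`:
# the REDUCTION of W to its two open inputs (kernel-checked composition)

Route `ResolutionOfSingularities/SeparableGalois`. This file is the sorry-free composition of the line:
with the three landed stubs (`stub_frobeniusCompositum` p165291, `stub_sandwichModel` p168617,
`stub_quotientModel` p165201) and Chow's lemma (`Resolution.exists_isBirational_finsetsInAffineOpens`,
proved) it proves

* `galoisQuotientModels_of_multiplicativeDefect_of_equivariantLogResolution`: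
  W ⟸ (MD) ∧ (ELR), where (MD) is the statement of the open stub `stub_multiplicativeDefect` — over a
  perfect field of characteristic `p` every integral separated finite-type `X` admits a de Jong datum
  `(G, X₁, ρ, π, n)` (`IsGaloisAlterationOfExponent`, de Jong 1997 Thm. 5.13) all of whose normal level-`n`
  sandwich models are Zariski log regular with `G` acting by log automorphisms (the line's conjecture
  MULT) — and (ELR) is the statement of the stub `stub_equivariantLogResolution` (equivariant
  Kato–Nizioł / Illusie–Temkin resolution of log regular schemes);
* `galoisQuotientModels_of_illusieTemkin2014_of_multiplicativeDefect`: W ⟸ (MD), CONDITIONALLY on the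
  named fact `IllusieTemkin2014_equivariantLogRegularResolution` (through the landed reduction
  `stub_equivariantLogResolution_of_illusieTemkin2014`, p166763).

So the crux hinges on exactly one unproved published fact (Illusie–Temkin 2014, Exp. VIII 3.4.9/3.4.15)
and one conjecture (MD ⊇ MULT); (MD) is itself a consequence of the summit over perfect fields (take a
resolution, `G = 1`, `n = 0`), so it is crux-sized, not refutable short of the summit.

Proof of the composition: Chow (replace `X` by a quasi-projective `X'` over it and compose the proper
birational maps, `IsBirational.comp`); take the datum of (MD); `K(X₁)` has characteristic `p`; stub 2
makes `Mₙ` `G`-stable with `Mₙ^G = K(X)`; stub 3 builds the normal sandwich model `X₁ —u→ Z —v→ X`;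
(MD) equips `Z` with a `G`-equivariant log regular atlas; (ELR) resolves it `G`-equivariantly,
`r : X' → Z`; then `π' := r ≫ v` is a `G`-invariant alteration from the regular `X'` whose `G`-fixed
rational functions come from `K(X)` (chase through `r♯, u♯, v♯`), i.e. `HasSeparableGaloisTop X`; stub 5
concludes. [cite: DeJong1997, Thm. 5.13]
-/

noncomputable section

-- single-problem summit: the doubled namespace component `ResolutionOfSingularities` is forced
set_option linter.dupNamespace false

open CategoryTheory AlgebraicGeometry TopologicalSpace
open Literature.AlgebraicGeometry.Resolution
open Literature.AlgebraicGeometry.Motives Literature.AlgebraicGeometry.Motives.RatFn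

namespace Summit.ResolutionOfSingularities.ResolutionOfSingularities.Theorems.GaloisQuotientModels

open Summit.ResolutionOfSingularities.ResolutionOfSingularities.Theses.SeparableGalois (GaloisQuotientModels)

/-- **W from (MD) and (ELR)** — the kernel-checked composition of the line
`inseparability-foliation-quotient` (see the module docstring for the proof). (MD) is the statement of
the registered stub `stub_multiplicativeDefect`, (ELR) that of `stub_equivariantLogResolution`.
[cite: DeJong1997, Thm. 5.13] -/
theorem galoisQuotientModels_of_multiplicativeDefect_of_equivariantLogResolution
    (hMD :
      ∀ (p : ℕ) [Fact p.Prime] (k : Type) [Field k] [CharP k p] [PerfectField k]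
      (X : Scheme.{0}) [IsIntegral X] (f : X ⟶ Spec (.of k)) [IsSeparated f]
      [LocallyOfFiniteType f] [QuasiCompact f],
      ∃ (G : Type) (_ : Group G) (_ : Finite G) (X₁ : Scheme.{0}) (_ : IsIntegral X₁)
      (ρ : G →* Aut X₁) (π : X₁ ⟶ X) (_ : IsDominant π) (n : ℕ),
      IsGaloisAlterationOfExponent p n ρ π ∧
      ∀ (Z : Scheme.{0}) [IsIntegral Z] (ρZ : G →* Aut Z) (u : X₁ ⟶ Z) [IsDominant u]
      (v : Z ⟶ X), IsSandwichModel p n ρ π ρZ u v →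
      ∃ 𝒜 : LogAtlas.{0} Z, 𝒜.IsLogRegular ∧ IsLogEquivariant 𝒜 ρZ)
    (hELR :
      ∀ (Z : Scheme.{0}) [IsIntegral Z] [CompactSpace Z] (𝒜 : LogAtlas.{0} Z) (G : Type)
      [Group G] [Finite G] (ρZ : G →* Aut Z), 𝒜.IsLogRegular → IsLogEquivariant 𝒜 ρZ →
      (∀ S : Finset Z, ∃ U : Z.Opens, IsAffineOpen U ∧ (↑S : Set Z) ⊆ U) →
      ∃ (X' : Scheme.{0}) (_ : IsIntegral X') (ρ' : G →* Aut X') (r : X' ⟶ Z) (_ : IsDominant r),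
      IsProper r ∧ IsBirational r ∧ Scheme.IsRegular X' ∧
      (∀ g : G, (ρ' g).hom ≫ r = r ≫ (ρZ g).hom) ∧
      (∀ S : Finset X', ∃ U : X'.Opens, IsAffineOpen U ∧ (↑S : Set X') ⊆ U) ∧
      Function.Bijective (functionFieldMap r) ∧
      (Function.Injective ρZ → Function.Injective ρ')) :
    GaloisQuotientModels := by
  intro p hp k _ _ _ X₀ f₀ hs₀ hl₀ hq₀ hi₀
  haveI : Fact p.Prime := ⟨hp⟩
  haveI := hs₀; haveI := hl₀; haveI := hq₀; haveI := hi₀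
  -- CHOW (proved in tree): replace `X₀` by a quasi-projective `X` over it, `π₀ : X → X₀` proper
  -- birational; finite subsets of `X` lie in affine opens, and a Galois-quotient model of `X`
  -- is one of `X₀` (compose the proper birational maps).
  obtain ⟨X, hiX, π₀, hπ₀, hb₀, hXaff⟩ := exists_isBirational_finsetsInAffineOpens X₀ f₀
  haveI := hiX; haveI := hπ₀
  let f : X ⟶ Spec (.of k) := π₀ ≫ f₀
  haveI : IsSeparated f := inferInstanceAs (IsSeparated (π₀ ≫ f₀))
  haveI : LocallyOfFiniteType f := inferInstanceAs (LocallyOfFiniteType (π₀ ≫ f₀))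
  haveI : QuasiCompact f := inferInstanceAs (QuasiCompact (π₀ ≫ f₀))
  suffices hc : GaloisQuotientConclusion X by
    obtain ⟨X₁, X', π, q, G, _, _, ρ, hπ, hbir, h1, h2, hreg, hfin, hsurj, het, hinv, horb⟩ := hc
    haveI := hπ
    exact ⟨X₁, X', π ≫ π₀, q, G, inferInstance, inferInstance, ρ, inferInstance, hbir.comp hb₀, h1,
      h2, hreg, hfin, hsurj, het, hinv, horb⟩
  -- STUB 1: de Jong datum with multiplicative defect
  obtain ⟨G, _, _, X₁, _, ρ, π, _, n, hGA, hmult⟩ := hMD p k X f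
  -- characteristic `p` on `K(X₁)` (through `k → Γ(X₁, ⊤) → K(X₁)`)
  haveI : CharP X₁.functionField p := by
    haveI : Nonempty (⊤ : X₁.Opens) := ⟨⟨genericPoint X₁, trivial⟩⟩
    exact (((X₁.germToFunctionField ⊤).hom.comp (((π ≫ f).appTop).hom.comp
      (Scheme.ΓSpecIso (.of k)).inv.hom)).charP_iff_charP p).mp inferInstance
  -- STUB 2 (landed): the Frobenius compositum is `G`-stable with fixed part `K(X)`
  obtain ⟨hstab, hfix⟩ := stub_frobeniusCompositum p n G X₁ X ρ π hGA.comp_eq hGA.pow_mem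
  -- STUB 3 (landed): the normal sandwich model `X₁ —u→ Z —v→ X`
  obtain ⟨Z, _, ρZ, u, _, v, hSW, hcpt, hv, haffZ, hρZ⟩ :=
    stub_sandwichModel p n k X f hXaff G X₁ ρ π hGA hstab
  -- STUB 1 again: `Z` is log regular, `G` acts by log automorphisms
  obtain ⟨𝒜, h𝒜, heqv⟩ := hmult Z ρZ u v hSW
  -- STUB 4: equivariant Kato–Nizioł resolution `r : X' → Z`
  haveI := hcpt
  obtain ⟨X', _, ρ', r, _, hr, hbir, hreg, hcomm, haffX', hbij, hinj⟩ := hELR Z 𝒜 G ρZ h𝒜 heqv haffZ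
  haveI := hr
  haveI := hv.isProper
  haveI := hv.isDominant
  -- the separable Galois top `π' := r ≫ v`
  have halt : IsAlteration (r ≫ v) := (hbir.isAlteration).comp hv
  have hinv' : ∀ g : G, (ρ' g).hom ≫ (r ≫ v) = r ≫ v := fun g => by
    rw [← Category.assoc, hcomm g, Category.assoc, hSW.inv g]
  have hfield : ∀ a : X'.functionField, (∀ g : G, functionFieldMap (ρ' g).hom a = a) →
      a ∈ Set.range (functionFieldMap (r ≫ v)) := by
    intro a ha
    obtain ⟨b, rfl⟩ := hbij.2 a
    -- `b ∈ K(Z)` is fixed by `ρZ`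
    have hb : ∀ g : G, functionFieldMap (ρZ g).hom b = b := by
      intro g
      apply hbij.1
      have e₁ : functionFieldMap ((ρ' g).hom ≫ r) = functionFieldMap (r ≫ (ρZ g).hom) := by
        have key : ∀ (φ ψ : X' ⟶ Z) [IsDominant φ] [IsDominant ψ], φ = ψ →
            functionFieldMap φ = functionFieldMap ψ := by
          rintro _ _ _ _ rfl; rfl
        exact key _ _ (hcomm g)
      have e₂ := congrArg (fun φ => φ b) e₁
      simp only [functionFieldMap_comp, RingHom.comp_apply] at e₂
      rw [ha g] at e₂
      exact e₂.symm
    -- `u♯ b ∈ Mₙ` is fixed by `ρ`, hence comes from `K(X)`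
    have hub : ∀ g : G, functionFieldMap (ρ g).hom (functionFieldMap u b) = functionFieldMap u b := by
      intro g
      have e₁ : functionFieldMap ((ρ g).hom ≫ u) = functionFieldMap (u ≫ (ρZ g).hom) := by
        have key : ∀ (φ ψ : X₁ ⟶ Z) [IsDominant φ] [IsDominant ψ], φ = ψ →
            functionFieldMap φ = functionFieldMap ψ := by
          rintro _ _ _ _ rfl; rfl
        exact key _ _ (hSW.comm g)
      have e₂ := congrArg (fun φ => φ b) e₁
      simp only [functionFieldMap_comp, RingHom.comp_apply] at e₂
      rw [hb g] at e₂
      exact e₂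
    have hmem : functionFieldMap u b ∈ frobeniusCompositum π p n := by
      have : functionFieldMap u b ∈ Set.range (functionFieldMap u) := ⟨b, rfl⟩
      rw [hSW.range_eq] at this
      exact this
    obtain ⟨d, hd⟩ := hfix _ hmem hub
    have e₃ : functionFieldMap π = functionFieldMap (u ≫ v) := by
      have key : ∀ (φ ψ : X₁ ⟶ X) [IsDominant φ] [IsDominant ψ], φ = ψ →
          functionFieldMap φ = functionFieldMap ψ := by
        rintro _ _ _ _ rfl; rfl
      exact key _ _ hSW.fac.symm
    rw [e₃, functionFieldMap_comp, RingHom.comp_apply] at hd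
    have hbd : b = functionFieldMap v d := (functionFieldMap u).injective hd.symm
    refine ⟨d, ?_⟩
    rw [functionFieldMap_comp, RingHom.comp_apply, ← hbd]
  have htop : HasSeparableGaloisTop X :=
    ⟨G, inferInstance, inferInstance, X', inferInstance, ρ', r ≫ v, inferInstance, halt, hreg,
      hinj hρZ, hinv', haffX', hfield⟩
  -- STUB 5 (landed): the Galois-quotient model
  exact stub_quotientModel k X f htop

/-- **W from (MD), conditionally on Illusie–Temkin 2014** (Exp. VIII, Thm. 3.4.9 / 3.4.15, the named
fact `IllusieTemkin2014_equivariantLogRegularResolution`, through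
`stub_equivariantLogResolution_of_illusieTemkin2014`). CONDITIONAL on that named fact.
[cite: IllusieTemkin2014ExpVIII, Thm. 3.4.9 and 3.4.15] [cite: DeJong1997, Thm. 5.13] -/
theorem galoisQuotientModels_of_illusieTemkin2014_of_multiplicativeDefect
    (hIT : IllusieTemkin2014_equivariantLogRegularResolution.{0})
    (hMD :
      ∀ (p : ℕ) [Fact p.Prime] (k : Type) [Field k] [CharP k p] [PerfectField k]
      (X : Scheme.{0}) [IsIntegral X] (f : X ⟶ Spec (.of k)) [IsSeparated f]
      [LocallyOfFiniteType f] [QuasiCompact f],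
      ∃ (G : Type) (_ : Group G) (_ : Finite G) (X₁ : Scheme.{0}) (_ : IsIntegral X₁)
      (ρ : G →* Aut X₁) (π : X₁ ⟶ X) (_ : IsDominant π) (n : ℕ),
      IsGaloisAlterationOfExponent p n ρ π ∧
      ∀ (Z : Scheme.{0}) [IsIntegral Z] (ρZ : G →* Aut Z) (u : X₁ ⟶ Z) [IsDominant u]
      (v : Z ⟶ X), IsSandwichModel p n ρ π ρZ u v →
      ∃ 𝒜 : LogAtlas.{0} Z, 𝒜.IsLogRegular ∧ IsLogEquivariant 𝒜 ρZ) :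
    GaloisQuotientModels :=
  galoisQuotientModels_of_multiplicativeDefect_of_equivariantLogResolution hMD
    (stub_equivariantLogResolution_of_illusieTemkin2014 hIT)

end Summit.ResolutionOfSingularities.ResolutionOfSingularities.Theorems.GaloisQuotientModels

end
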